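import Summits.ResolutionOfSingularities.ResolutionOfSingularities.Theorems.MarkedTransferCampaignW46ThreefoldsStepExists
import Literature.AlgebraicGeometry.Resolution.RegularCentreComponents
import HarnessLib

/-!
# [OURS · L1 W4.6 rung (ii)] STEP EXISTENCE IS A KERNEL FACT IN GENERAL (perfect base field): every irreducible component of
# the smooth terminal plat is an admitted centre, its blow-up an ambient datum — so résumé COVERAGE alone turns
# termination into Γ-free order reduction (proofs)

Cell res-hironaka, LADDER-RESOLUTION rung L (D-0089), slot W4.6, rung (ii); seat res-L1-s46-pv-3 (gen 2). Host route
MarkedTransfer, host item `HypersurfaceOrderReductionDimLeThree` (stmt-16156); `--kind proof --supports` it. Companion of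
`…ThreefoldsStepExists` (the irreducible case), `…ThreefoldsResolved` (exhaustion ⇒ LSB), `…ThreefoldsProgress`, and the
tree's `Resolution.RegularCentreComponents` (Stacks 0357: a regular closed subscheme of a Noetherian scheme is the disjoint
union of its irreducible components, each regular with its reduced structure).

HONEST FRAMING. Everything below is OURS: kernel theorems over the campaign shapes and the tree's blow-up / regular-centre
library. NOTHING here is a statement of H. Hironaka's manuscript (2017-03-23, [Hironaka2017]) and nothing asserts that any
statement of it holds; the résumé's Def. 15.12 fields («`∇(E)` smooth closed non-empty `⊆ Sing(E)`») and all shapes are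
HYPOTHESES carried by the data. AI review is weaker than expert review.

## What

* `Resume.isCentre_of_mem_componentsIn` (perfect `K`): EVERY irreducible component `D` of the terminal plat `∇(E)` of a
  résumé is admitted by the literal centre rule — `D ⊆ ∇(E)`, irreducible, and SMOOTH over `K`: the reduced subscheme
  `V(𝓘_∇)` is regular (smooth over a field), its irreducible components are pairwise disjoint and each `V(𝓘_D)` is regular
  (tree `isRegular_subscheme_vanishingIdeal_piece`, Stacks 0357), hence smooth over the perfect `K` (Matsumura §30).
* `Resume.exists_stepNabla` (perfect `K`): from every state with a résumé SOME ∇-step exists (pick a component, blow it up: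
  `exists_isBlowup`; the result is an ambient datum as in `…ThreefoldsStepExists`). Hence `NablaStepExists N Rd Rg` holds
  for EVERY `N`, `Rd`, `Rg` (`nablaStepExists`) — the progress hypothesis is DISCHARGED up to résumé coverage.
* CAPSTONE OF RUNG (ii) (`exists_isPermissibleLSB_hostState_of_cover`): for the NAMED `N`, `Rd` and ANY string reading `σ`,
  the five `σ`-shapes at `regimeII` together with résumé coverage of the standard unresolved regime-(ii) states
  (`ResumesCover`, the manuscript's posited résumé existence, row 091) imply Γ-FREE HYPERSURFACE ORDER REDUCTION for every
  input `(k, X, I ≠ 0, m ≥ 1)` of stmt-16156 (`k` perfect): an `(I, m)`-permissible LSB `σ′ : Z′ → X` (typed Def. 2.4)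
  with last transform of order `< m` everywhere. 16156's `IsMarkedResolution` (boundary, snc) is neither used nor derived.

References: `…ThreefoldsStepExists` (p488135), `…ThreefoldsResolved` (p487519), `…ThreefoldsProgress` v2 (p487787),
`…StringReadingReductionSing` (p486807); tree `RegularCentreComponents` / `KollarSplitBoundary` [StacksProject Tag 0357,
BierstoneGrigorievMilmanWlodarczyk2011 §4 Step 2], `BlowupsExistence`, `RegularBlowup` [Liu2002], `SmoothOfRegularPerfectField`
[Matsumura1987]. H. Hironaka, ms. 2017-03-23, Def. 15.12 p.80 l.36 – p.81 l.4, Th. 16.6 p.84 l.4–6, §16.3 p.87 — scope only,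
under adjudication, not cited as fact. [Hironaka2017]
-/

noncomputable section

set_option linter.dupNamespace false -- mandated namespace of this single-conjunct summit

open CategoryTheory AlgebraicGeometry TopologicalSpace

namespace Summit.ResolutionOfSingularities.ResolutionOfSingularities.Theorems

namespace CampaignW46

open Literature.AlgebraicGeometry.Resolution
open Literature.AlgebraicGeometry.Hironaka2017
open Literature.AlgebraicGeometry.Hironaka2017.S02Preliminaries
open Literature.AlgebraicGeometry.Hironaka2017.Datum
open Literature.AlgebraicGeometry.Hironaka2017.S15ARSchemes
open Literature.AlgebraicGeometry.Hironaka2017.S16Proof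

universe u

variable {n : ℕ} {p : ℕ} [Fact p.Prime] {K : Type u} [Field K] [CharP K p]

/-! ## Components of the terminal plat are admitted centres -/

section Components

variable {N : Notions.{u} n} {A : AmbientDatum p K} {E : IdealExponent A.Z} (R : Resume N A E)

/-- Pure logic: an irreducible component of `∇(E)` in the sense of the tree's `Resolution.componentsIn` is a ∇-component
in the sense of design finding D1 (`IsNablaComponent`; converse of `IsNablaComponent.mem_componentsIn`). [folklore] -/
theorem isNablaComponent_of_mem_componentsIn {D : Closeds A.Z}
    (h : (D : Set A.Z) ∈ componentsIn (R.nabla : Set A.Z)) : IsNablaComponent R D := by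
  obtain ⟨hsub, hirr, hmax⟩ := mem_componentsIn_iff.mp h
  exact ⟨hsub, hirr, fun S hS hDS hSn => Set.Subset.antisymm (hmax S hSn hS hDS) hDS⟩

/-- A closed subset of the terminal plat has non-zero ideal (it misses the generic point, which is not singular for the
standard `E`). [folklore] -/
theorem Resume.vanishingIdeal_ne_bot_of_subset_nabla {D : Closeds A.Z} (hD : (D : Set A.Z) ⊆ (R.nabla : Set A.Z)) :
    Scheme.IdealSheafData.vanishingIdeal D ≠ ⊥ := by
  obtain ⟨-, -, hint⟩ := ambientZ_std A
  haveI := hint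
  have hE : E.IsStandard := R.mti_isStandard.1
  intro h
  have hgen : genericPoint A.Z ∈ (D : Set A.Z) := by
    rw [← Scheme.IdealSheafData.coe_support_vanishingIdeal D, h, Scheme.IdealSheafData.support_bot]
    trivial
  have hsing : (E.b : ℕ∞) ≤ idealOrder E.J (genericPoint A.Z) := R.nabla_subset_sing (hD hgen)
  have hb : (1 : ℕ∞) ≤ (E.b : ℕ∞) := by exact_mod_cast (hE.2 : 1 ≤ E.b)
  exact not_mem_support_genericPoint hE.1 ((one_le_idealOrder_iff E.J _).mp (hb.trans hsing))

/-- The reduced closed subscheme `V(𝓘_∇)` on the terminal plat is REGULAR: it is smooth over the field `K` by the résumé's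
Def. 15.12 hypothesis field (EGA IV 17.5.8). [folklore] -/
theorem Resume.isRegular_nablaSubscheme :
    Scheme.IsRegular (Scheme.IdealSheafData.vanishingIdeal R.nabla).subscheme := by
  have hN : IsSmoothClosedNonempty A.hom (R.𝒴.nabla R.T) := R.nabla_smooth
  obtain ⟨hNcl, -, hNsm⟩ := hN
  have hsm : Smooth ((Scheme.IdealSheafData.vanishingIdeal R.nabla).subschemeι ≫ A.hom) := hNsm
  exact @Scheme.IsRegular.of_smooth _ _ ((Scheme.IdealSheafData.vanishingIdeal R.nabla).subschemeι ≫ A.hom) hsm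
    inferInstance (Scheme.isRegular_Spec (CommRingCat.of K))

/-- The terminal plat of a résumé is non-empty (Def. 15.12 hypothesis field). [folklore] -/
theorem Resume.nabla_nonempty : (R.nabla : Set A.Z).Nonempty := by
  have hN : IsSmoothClosedNonempty A.hom (R.𝒴.nabla R.T) := R.nabla_smooth
  obtain ⟨-, hNne, -⟩ := hN
  exact hNne

/-- **EVERY IRREDUCIBLE COMPONENT OF THE TERMINAL PLAT IS AN ADMITTED CENTRE** (perfect `K`): `D ⊆ ∇(E)`, irreducible,
and smooth over `K` — the regular `V(𝓘_∇)` is the disjoint union of its components, each regular with its reduced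
structure (Stacks 0357, tree `isRegular_subscheme_vanishingIdeal_piece`), hence smooth over the perfect field
(Matsumura §30). [cite: StacksProject, Tag 0357] -/
theorem Resume.isCentre_of_mem_componentsIn [PerfectField K] {D : Closeds A.Z}
    (h : (D : Set A.Z) ∈ componentsIn (R.nabla : Set A.Z)) : IsCentre R D := by
  haveI := A.smooth
  haveI := A.quasiCompact
  obtain ⟨hln, -, -⟩ := ambientZ_std A
  haveI := hln
  haveI : CompactSpace A.Z := QuasiCompact.compactSpace_of_compactSpace A.hom
  haveI : IsNoetherian A.Z := {}
  have hC := R.isRegular_nablaSubscheme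
  have hsupp : ((Scheme.IdealSheafData.vanishingIdeal R.nabla).support : Set A.Z) = (R.nabla : Set A.Z) :=
    Scheme.IdealSheafData.coe_support_vanishingIdeal _
  have hZ : D ∈ Kollar2007.boundaryPieces (Scheme.IdealSheafData.vanishingIdeal R.nabla) := by
    rw [Kollar2007.mem_boundaryPieces_iff, hsupp]
    exact h
  have hreg : Scheme.IsRegular (Scheme.IdealSheafData.vanishingIdeal D).subscheme :=
    isRegular_subscheme_vanishingIdeal_piece hC (isPiecePartition_boundaryPieces_of_isRegular hC) hZ
  exact ⟨componentsIn.subset h, componentsIn.isIrreducible h, smooth_of_isRegular_of_perfectField _ hreg⟩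

/-- **STEP EXISTENCE (perfect `K`, no further hypothesis).** From every state with a résumé SOME ∇-step exists: blow up
`Z` along an irreducible component of `∇(E)` (admitted by `Resume.isCentre_of_mem_componentsIn`; the blow-up exists,
tree `exists_isBlowup`, and is an ambient datum — integral, regular by Liu 8.1.19 (a), smooth over the perfect field,
quasi-compact). [cite: Liu2002, Thm. 8.1.19 (a)] -/
theorem Resume.exists_stepNabla [PerfectField K] : ∃ A' : AmbientDatum p K, Nonempty (StepNabla R A') := by
  haveI := A.smooth
  haveI := A.quasiCompact
  obtain ⟨hln, hZreg, hint⟩ := ambientZ_std A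
  haveI := hln
  haveI := hint
  obtain ⟨x, hx⟩ := R.nabla_nonempty
  obtain ⟨D₀, hD₀, -⟩ := componentsIn.exists_mem hx
  let D : Closeds A.Z := ⟨D₀, componentsIn.isClosed R.nabla.isClosed hD₀⟩
  have hD : (D : Set A.Z) ∈ componentsIn (R.nabla : Set A.Z) := hD₀
  have hcentre : IsCentre R D := R.isCentre_of_mem_componentsIn hD
  have hreg : Scheme.IsRegular (Scheme.IdealSheafData.vanishingIdeal D).subscheme := hcentre.isRegular_subscheme
  obtain ⟨Z', π, hπ⟩ := exists_isBlowup A.Z (Scheme.IdealSheafData.vanishingIdeal D)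
  haveI : IsIntegral Z' := hπ.isIntegral (R.vanishingIdeal_ne_bot_of_subset_nabla (componentsIn.subset hD))
  haveI : IsProper π := hπ.isProper
  have hZ'reg : Scheme.IsRegular Z' := hπ.isRegular_of_isRegular_subscheme hZreg hreg
  haveI : Smooth (π ≫ A.hom) := smooth_of_isRegular_of_perfectField _ hZ'reg
  let A' : AmbientDatum p K :=
    { Z := Z', hom := π ≫ A.hom, irreducible := inferInstance, smooth := inferInstance, quasiCompact := inferInstance }
  let s : Step R A' := { D := D, centre := hcentre, π := π, hom_eq := rfl, blowup := hπ }
  exact ⟨A', ⟨⟨s, isNablaComponent_of_mem_componentsIn R hD⟩⟩⟩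

end Components

/-! ## Step existence discharged; progress from coverage alone -/

section Discharge

variable {N : Notions.{u} n} {Rd : Reading p K N} {Rg : Regime p K}

/-- **`NablaStepExists` HOLDS UNCONDITIONALLY over a perfect field** (for every notion instance, reading and regime): the
résumé's own Def. 15.12 hypothesis fields and the tree's blow-up library supply the step. [folklore] -/
theorem nablaStepExists [PerfectField K] (N : Notions.{u} n) (Rd : Reading p K N) (Rg : Regime p K) :
    NablaStepExists N Rd Rg :=
  fun _ _ R _ _ => R.exists_stepNabla

/-- In regime (ii), PROGRESS follows from résumé COVERAGE ALONE (perfect `K`). [folklore] -/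
theorem progress_regimeII_of_cover [PerfectField K]
    (hC : ResumesCover N Rd fun A E => regimeII A E ∧ E.IsStandard ∧ E.sing.Nonempty) :
    Progress N Rd (Regime.inter regimeII fun _ E => E.IsStandard) :=
  progress_regimeII (nablaStepExists N Rd regimeII) hC

/-- **RUNG (ii), EXHAUSTION FROM TERMINATION AND COVERAGE** (perfect `K`): `TerminatesNablaII N Rd` and résumé coverage of
the standard unresolved regime-(ii) states imply that every standard threefold-hypersurface state is resolved by an
`E`-permissible LSB. [folklore] -/
theorem exists_isPermissibleLSB_of_regimeII_of_cover [PerfectField K] (hT : TerminatesNablaII N Rd)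
    (hC : ResumesCover N Rd fun A E => regimeII A E ∧ E.IsStandard ∧ E.sing.Nonempty)
    {A : AmbientDatum p K} {E : IdealExponent A.Z} (hRg : regimeII A E) (hE : E.IsStandard) :
    ∃ (Z' : Scheme.{u}) (σ : Z' ⟶ A.Z) (J' : Z'.IdealSheafData),
      IsPermissibleLSB E.J E.b σ J' ∧ (⟨J', E.b⟩ : IdealExponent Z').sing = ∅ :=
  exists_isPermissibleLSB_of_regimeII hT (nablaStepExists N Rd regimeII) hC hRg hE

end Discharge

/-! ## The capstone in the words of the host item -/

section Host

variable {k : Type u} [Field k] [CharP k p] {N : Notions.{u} n} {Rd : Reading p k N}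

/-- **CAPSTONE OF RUNG (ii): Γ-FREE HYPERSURFACE ORDER REDUCTION IN DIMENSION ≤ 3 FROM THE FIVE SHAPES AND RÉSUMÉ
COVERAGE.** For the NAMED notion instance `N`, reading `Rd` and ANY string reading `σ` (e.g. (M) `readingM N`, (M⁺)
`readingMSucc N`): if at the threefold-hypersurface states the `σ`-strings satisfy Eq. (127) over the centre off `∇′`
(`DecreaseShape`), the prefix form of Eq. (128) on `∇′` (`PrefixShape`), `m′ ≤ m` (`StopsShape`), «`∇(E)` = top stratum of
`Sing(E)`» (`TopSingShape`) and «no increase off the centre at singular points» (`MonotoneSingShape`), and if the résumés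
of `N` COVER the standard unresolved regime-(ii) states (`ResumesCover`, the manuscript's posited résumé existence), then
for EVERY input of stmt-16156 — `k` perfect of characteristic `p`, `X` integral regular locally of finite type
quasi-compact over `k` with `topologicalKrullDim X ≤ 3`, `I ≠ 0` effective Cartier, `m ≥ 1` — there is an
`(I, m)`-permissible LSB `σ′ : Z′ → X` (typed Def. 2.4) whose last transform `J′` has `ord_x J′ < m` at every point of
`Z′`. All hypotheses concern the résumés of `N`; step existence is a kernel fact (`nablaStepExists`). HONEST LIMIT: not
16156's `IsMarkedResolution` (no boundary / snc); 16156 is neither used nor derived. [folklore] -/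
theorem exists_isPermissibleLSB_hostState_of_cover [PerfectField k] (σ : StringReading p k N)
    (hD : σ.DecreaseShape Rd regimeII) (hP : σ.PrefixShape Rd regimeII) (hM : σ.StopsShape Rd regimeII)
    (hT : σ.TopSingShape Rd regimeII) (hL : σ.MonotoneSingShape Rd regimeII)
    (hC : ResumesCover N Rd fun A E => regimeII A E ∧ E.IsStandard ∧ E.sing.Nonempty) (X : Scheme.{u})
    (s : X ⟶ Spec (.of k)) [LocallyOfFiniteType s] [QuasiCompact s] [IsIntegral X] (hreg : Scheme.IsRegular X)
    (hdim : topologicalKrullDim X ≤ 3) (I : X.IdealSheafData) (hI0 : I ≠ ⊥) (hIc : IsEffectiveCartier I) (m : ℕ)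
    (hm : 1 ≤ m) :
    ∃ (Z' : Scheme.{u}) (σ' : Z' ⟶ X) (J' : Z'.IdealSheafData),
      IsPermissibleLSB I m σ' J' ∧ ∀ x : Z', idealOrder J' x < m :=
  exists_isPermissibleLSB_hostState (terminatesNablaII_of_shapes_sing N Rd σ hD hP hM hT hL)
    (nablaStepExists N Rd regimeII) hC X s hreg hdim I hI0 hIc m hm

/-- The same with termination taken as the registered shape `TerminatesNablaII N Rd` directly (any proof of it — e.g. the
(M) or (M⁺) rungs): `TerminatesNablaII → ResumesCover … →` Γ-free order reduction of every input of stmt-16156.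
[folklore] -/
theorem exists_isPermissibleLSB_hostState_of_terminates [PerfectField k] (hT : TerminatesNablaII N Rd)
    (hC : ResumesCover N Rd fun A E => regimeII A E ∧ E.IsStandard ∧ E.sing.Nonempty) (X : Scheme.{u})
    (s : X ⟶ Spec (.of k)) [LocallyOfFiniteType s] [QuasiCompact s] [IsIntegral X] (hreg : Scheme.IsRegular X)
    (hdim : topologicalKrullDim X ≤ 3) (I : X.IdealSheafData) (hI0 : I ≠ ⊥) (hIc : IsEffectiveCartier I) (m : ℕ)
    (hm : 1 ≤ m) :
    ∃ (Z' : Scheme.{u}) (σ' : Z' ⟶ X) (J' : Z'.IdealSheafData),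
      IsPermissibleLSB I m σ' J' ∧ ∀ x : Z', idealOrder J' x < m :=
  exists_isPermissibleLSB_hostState hT (nablaStepExists N Rd regimeII) hC X s hreg hdim I hI0 hIc m hm

end Host

end CampaignW46

end Summit.ResolutionOfSingularities.ResolutionOfSingularities.Theorems

end
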